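import Summits.NavierStokesRegularity.NavierStokesRegularity.Theses.SelfMixingDichotomy
import Summits.NavierStokesRegularity.NavierStokesRegularity.Theorems.SelfMixingDichotomyMixingPayoffMassExportCorollaries
import Summits.NavierStokesRegularity.NavierStokesRegularity.Theorems.SelfMixingDichotomyCoherentScaleExclusionFloors
import HarnessLib

/-!
# Crux `MixingPayoff` (stmt-NavierStokesRegularity-1422), line `registered` (= `birth`):
# the crux is a pure NON-EXISTENCE statement — no standing solution is cofinally `δ`-mixing

Support file (`--supports stmt-NavierStokesRegularity-1422`, continuation lead c1). The crux

  P = `MixingPayoff`: there is an absolute `δ > 0` such that every standing solution (`ν = 1`,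
  classical on `[0,T)`, Leray–Hopf from `u 0`, rapidly decaying datum) whose drift is cofinally
  `δ`-mixing at `(T, x₀)` (`DissipatesAtScale u T x₀ r δ` for all `r ∈ (0, r₀)`) is bounded near
  `(T, x₀)` (BDD),

is shown here to be EQUIVALENT to the bare non-existence statement

  N: there is an absolute `δ > 0` such that NO standing solution is cofinally `δ`-mixing at ANY
  point `(T, x₀)`

(`mixingPayoff_iff_noCofinalMixing`). `N → P` is trivial (the antecedent of P is never met);
`P → N` uses the landed corollary of mass export `mixingPayoff_not_cofinallyMixing_of_bounded`
(a point near which `u` is bounded is never cofinally `δ`-mixing for `δ ≤ δ₀`): with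
`δ* = min δ δ₀`, cofinal `δ*`-mixing would give BDD by P and then contradict itself. So the
conclusion BDD of the crux — and the Type-I(K) conclusion of the line's open heart H
(`stub_mixingForcesTypeI`, `mixingPayoff_iff_mixingForcesTypeI`) — carry no information: for
small `δ` the three statements P(δ), H(δ, K) (`δ < c₁(K)`), N(δ) coincide
(`mixingPayoff_payoffAt_iff_noCofinalMixingAt` is the pointwise-in-`δ` form, valid for every
`0 < δ ≤ δ₀`). What a proof of the crux must produce is, for every standing solution and every
point, a sequence of scales `r_k → 0` and admissible scalars launched from blobs in `B_{r_k}(x₀)`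
that keep MORE than the fraction `δ` of their `L²` norm over `[T − r_k², T − r_k²/2]`.

The third theorem places the would-be counterexample in the route's trichotomy: by the load
floor of the sibling crux S2 (`coherentScaleExclusion_loadFloor`, landed unconditionally), a
cofinally `δ`-mixing point with `δ ≤ δ₁(M)` has local Reynolds number `cknC ρ (T, x₀) u > M` at
EVERY small scale `ρ` (`mixingPayoff_load_of_cofinallyMixing`): together with
`mixingPayoff_not_cofinallyMixing_of_bounded` (it is a singular point) and
`mixingPayoff_typeIRatio_lower_bound` (Type-I ratio `≥ c' δ^{-2/3}` in every parabolic cylinder)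
this is the complete list of proved necessary conditions on a counterexample to P.

Everything here is unconditional (standard axioms); no definitions, no named facts.
-/

noncomputable section

open Literature.Analysis.FluidPDE MeasureTheory Set Function Metric

-- `Summit = Problem` for this summit; the tree lakefile sets `weak.linter.dupNamespace = false`,
-- made explicit here for out-of-tree `lean check`.
set_option linter.dupNamespace false

namespace Summit.NavierStokesRegularity.NavierStokesRegularity.Theorems

open Summit.NavierStokesRegularity.NavierStokesRegularity.Theses.SelfMixingDichotomy (MixingPayoff)

/-- **`MixingPayoff` ⇔ no standing solution is cofinally `δ`-mixing anywhere.** The crux P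
(`∃ δ > 0`, cofinal `δ`-mixing at `(T, x₀)` ⇒ bounded near `(T, x₀)`) holds if and only if
there is an absolute `δ > 0` such that for every standing solution (`0 < T`, classical on
`[0,T)` with `ν = 1`, Leray–Hopf from `u 0`, rapidly decaying datum) and every `x₀` the drift is
NOT cofinally `δ`-mixing at `(T, x₀)`. `←`: the antecedent of P is never met. `→`: with `δ` from
P and `δ₀` from `mixingPayoff_not_cofinallyMixing_of_bounded`, put `δ* = min δ δ₀`; cofinal
`δ*`-mixing at `(T, x₀)` is cofinal `δ`-mixing (`DissipatesAtScale.mono`), so P gives boundedness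
near `(T, x₀)`, which excludes cofinal `δ*`-mixing there (`δ* ≤ δ₀`). -/
theorem mixingPayoff_iff_noCofinalMixing :
    MixingPayoff ↔
    (∃ δ : ℝ, 0 < δ ∧
      ∀ (T : ℝ) (u : ℝ → EuclideanSpace ℝ (Fin 3) → EuclideanSpace ℝ (Fin 3))
        (p : ℝ → EuclideanSpace ℝ (Fin 3) → ℝ), 0 < T →
      IsClassicalNSSolutionOn (Set.Ico 0 T) 1 0 u p → IsLerayHopfOn T 1 0 (u 0) u →
      HasRapidSpatialDecay (u 0) → ∀ x₀ : EuclideanSpace ℝ (Fin 3),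
      ¬ (∃ r₀ : ℝ, 0 < r₀ ∧ ∀ r ∈ Set.Ioo 0 r₀, DissipatesAtScale u T x₀ r δ)) := by
  constructor
  · rintro ⟨δ, hδ, hP⟩
    obtain ⟨δ₀, hδ₀, hNC⟩ := mixingPayoff_not_cofinallyMixing_of_bounded
    have hδs : 0 < min δ δ₀ := lt_min hδ hδ₀
    refine ⟨min δ δ₀, hδs, ?_⟩
    intro T u p hT hcl hLH hdec x₀ hmix
    obtain ⟨r₀, hr₀, hmix'⟩ := hmix
    have hbdd : ∃ ρ : ℝ, 0 < ρ ∧ ∃ M : ℝ, ∀ t ∈ Set.Ioo (T - ρ ^ 2) T,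
        ∀ x ∈ Metric.ball x₀ ρ, ‖u t x‖ ≤ M :=
      hP T hT u p hcl hLH hdec x₀
        ⟨r₀, hr₀, fun r hr => (hmix' r hr).mono hδs.le (min_le_left _ _)⟩
    exact hNC T u p hT hcl hLH hdec x₀ hbdd (min δ δ₀) hδs (min_le_right _ _) ⟨r₀, hr₀, hmix'⟩
  · rintro ⟨δ, hδ, hN⟩
    refine ⟨δ, hδ, ?_⟩
    intro T hT u p hcl hLH hdec x₀ hmix
    exact absurd hmix (hN T u p hT hcl hLH hdec x₀)

/-- **Pointwise in `δ`: payoff at `δ` ⇔ no cofinal `δ`-mixing, for every `0 < δ ≤ δ₀`.** With the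
absolute `δ₀` of `mixingPayoff_not_cofinallyMixing_of_bounded`: for each fixed `δ ∈ (0, δ₀]` the
implication "cofinally `δ`-mixing at `(T, x₀)` ⇒ bounded near `(T, x₀)`" holds for all standing
solutions and points if and only if no standing solution is cofinally `δ`-mixing at any point
(a bounded point is never cofinally `δ`-mixing, so the implication can only hold vacuously). -/
theorem mixingPayoff_payoffAt_iff_noCofinalMixingAt :
    ∃ δ₀ : ℝ, 0 < δ₀ ∧ ∀ δ : ℝ, 0 < δ → δ ≤ δ₀ →
    ((∀ (T : ℝ) (u : ℝ → EuclideanSpace ℝ (Fin 3) → EuclideanSpace ℝ (Fin 3))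
        (p : ℝ → EuclideanSpace ℝ (Fin 3) → ℝ), 0 < T →
      IsClassicalNSSolutionOn (Set.Ico 0 T) 1 0 u p → IsLerayHopfOn T 1 0 (u 0) u →
      HasRapidSpatialDecay (u 0) → ∀ x₀ : EuclideanSpace ℝ (Fin 3),
      (∃ r₀ : ℝ, 0 < r₀ ∧ ∀ r ∈ Set.Ioo 0 r₀, DissipatesAtScale u T x₀ r δ) →
      ∃ ρ : ℝ, 0 < ρ ∧ ∃ M : ℝ, ∀ t ∈ Set.Ioo (T - ρ ^ 2) T, ∀ x ∈ Metric.ball x₀ ρ,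
        ‖u t x‖ ≤ M) ↔
     (∀ (T : ℝ) (u : ℝ → EuclideanSpace ℝ (Fin 3) → EuclideanSpace ℝ (Fin 3))
        (p : ℝ → EuclideanSpace ℝ (Fin 3) → ℝ), 0 < T →
      IsClassicalNSSolutionOn (Set.Ico 0 T) 1 0 u p → IsLerayHopfOn T 1 0 (u 0) u →
      HasRapidSpatialDecay (u 0) → ∀ x₀ : EuclideanSpace ℝ (Fin 3),
      ¬ (∃ r₀ : ℝ, 0 < r₀ ∧ ∀ r ∈ Set.Ioo 0 r₀, DissipatesAtScale u T x₀ r δ))) := by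
  obtain ⟨δ₀, hδ₀, hNC⟩ := mixingPayoff_not_cofinallyMixing_of_bounded
  refine ⟨δ₀, hδ₀, fun δ hδ hδδ₀ => ⟨fun hP T u p hT hcl hLH hdec x₀ hmix => ?_,
    fun hN T u p hT hcl hLH hdec x₀ hmix => ?_⟩⟩
  · exact hNC T u p hT hcl hLH hdec x₀ (hP T u p hT hcl hLH hdec x₀ hmix) δ hδ hδδ₀ hmix
  · exact absurd hmix (hN T u p hT hcl hLH hdec x₀)

/-- **Cofinally mixing points are loaded at every small scale.** For every `M > 0` there is
`δ₁ = δ₁(M) > 0` (the load-floor threshold of the sibling crux S2,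
`coherentScaleExclusion_loadFloor`) such that if a standing solution is cofinally `δ`-mixing at
`(T, x₀)` with `0 ≤ δ ≤ δ₁`, then the local Reynolds number exceeds `M` at EVERY sufficiently
small scale: `ENNReal.ofReal M < cknC ρ (T, x₀) u` for all `ρ ∈ (0, ρ₀)`. Proof: for
`ρ < min (A r₀) √T` put `r = ρ / A(M)`; then `r < r₀`, `(A r)² = ρ² < T`, and a load `≤ M` at
scale `A r = ρ` would forbid `δ₁`-mixing at scale `r` — but the point is `δ`-mixing there and
`δ ≤ δ₁` (`DissipatesAtScale.mono`). So a counterexample to the crux `MixingPayoff` lies, for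
`δ ≤ δ₁(M)`, outside the antecedent `liminf_{ρ → 0} C(ρ) ≤ M` of the sibling crux S1
(`SequentialTypeIExclusion`). -/
theorem mixingPayoff_load_of_cofinallyMixing :
    ∀ M : ℝ, 0 < M → ∃ δ₁ : ℝ, 0 < δ₁ ∧
    ∀ (T : ℝ) (u : ℝ → EuclideanSpace ℝ (Fin 3) → EuclideanSpace ℝ (Fin 3))
      (p : ℝ → EuclideanSpace ℝ (Fin 3) → ℝ), 0 < T →
    IsClassicalNSSolutionOn (Set.Ico 0 T) 1 0 u p → IsLerayHopfOn T 1 0 (u 0) u →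
    HasRapidSpatialDecay (u 0) → ∀ (x₀ : EuclideanSpace ℝ (Fin 3)) (δ : ℝ), 0 ≤ δ → δ ≤ δ₁ →
    (∃ r₀ : ℝ, 0 < r₀ ∧ ∀ r ∈ Set.Ioo 0 r₀, DissipatesAtScale u T x₀ r δ) →
    ∃ ρ₀ : ℝ, 0 < ρ₀ ∧ ∀ ρ ∈ Set.Ioo 0 ρ₀,
      ENNReal.ofReal M < cknC ρ ((T, x₀) : ℝ × EuclideanSpace ℝ (Fin 3)) u := by
  intro M hM
  obtain ⟨δ₁, hδ₁, A, hA, hLF⟩ := coherentScaleExclusion_loadFloor M hM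
  refine ⟨δ₁, hδ₁, ?_⟩
  intro T u p hT hcl hLH hdec x₀ δ hδ0 hδδ₁ hmix
  obtain ⟨r₀, hr₀, hmix⟩ := hmix
  have hA0 : 0 < A := lt_of_lt_of_le one_pos hA
  refine ⟨min (A * r₀) (Real.sqrt T), lt_min (mul_pos hA0 hr₀) (Real.sqrt_pos.2 hT), ?_⟩
  intro ρ hρ
  have hρ0 : 0 < ρ := hρ.1
  have hρA : ρ < A * r₀ := lt_of_lt_of_le hρ.2 (min_le_left _ _)
  have hρT : ρ < Real.sqrt T := lt_of_lt_of_le hρ.2 (min_le_right _ _)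
  -- the scale `r = ρ / A`
  have hr : 0 < ρ / A := div_pos hρ0 hA0
  have hrr₀ : ρ / A < r₀ := by
    rw [div_lt_iff₀ hA0]
    linarith [mul_comm A r₀]
  have hAr : A * (ρ / A) = ρ := by field_simp
  have hρ2T : (A * (ρ / A)) ^ 2 < T := by
    rw [hAr]
    calc ρ ^ 2 < Real.sqrt T ^ 2 := by gcongr
      _ = T := Real.sq_sqrt hT.le
  by_contra hle
  have hle' : cknC (A * (ρ / A)) ((T, x₀) : ℝ × EuclideanSpace ℝ (Fin 3)) u ≤ ENNReal.ofReal M := by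
    rw [hAr]
    exact not_lt.1 hle
  have hmixr : DissipatesAtScale u T x₀ (ρ / A) δ₁ := (hmix (ρ / A) ⟨hr, hrr₀⟩).mono hδ0 hδδ₁
  exact hLF T hT u p hcl hLH hdec x₀ (ρ / A) hr hρ2T hle' hmixr

end Summit.NavierStokesRegularity.NavierStokesRegularity.Theorems

end
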